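import Summits.QuantumFields.YangMills.Theorems.WeakCouplingRatesColdBoxDirichletPosDef
import Mathlib.Algebra.Order.Chebyshev

/-!
# LINE-17 of crux `BoxMidWindowsSU22` (stmt-QuantumFields-24003), stub D `DirPoincareCubic` — part 1/3:
# per-edge comb bounds for the temporal-gauge Dirichlet box (linear twin of `WeakCouplingRatesColdBoxForestPoincare`)

Registered stub D of LINE-17 «hypercontractive second-order tilt expansion» (planner ym-idea-2 g14, skeleton v3 sha16
`4747b363e792659d`, critic idea-crit-4 g8 PASS) is the ℓ² FOREST POINCARÉ INEQUALITY `λ_max(Q_D⁻¹) ≤ c·H³` for the precision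
matrix `Q_D = Qmat (· ∉ dirFreeEdges H) dirCorner (2H+3)` of the Dirichlet Maxwell Gaussian `boxDirichlet H` of the cold-wall box
`{0,…,2H}⁴` in the temporal gauge (D1' of `Theorems/WeakCouplingRatesDefs.lean`).  Equivalently (`Q_D` symmetric positive definite,
`posDef_dirQmat`): the discrete Poincaré inequality `Σ_e s(e)² ≤ c·H³ · Σ_p circ_s(p)²` for every real edge configuration `s`
vanishing off the cold box and on the interior temporal forest.  This file proves the PER-EDGE comb bounds of that inequality in the
abstract setting `s : ZdEdge 4 → ℝ`, `s = 0` off `boxEdges 4 (2H+1)` (`hout`) and on the forest (`hforest`) — exactly the hypotheses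
satisfied by the glued free variables `dirGlue H v` (`dirGlue_eq_zero_of_not_mem`, `dirGlue_eq_zero_of_forest`).  Coordinates
`(t, z) ∈ ℤ × ℤ³` (sites `Fin.cons t z`); all plaquettes used are TEMPORAL plaquettes `((t,w); 0, j+1)`:

* `s_bottom_spatial_eq` — a bottom-face spatial edge `((0,y), j+1)` IS the circulation of the collar plaquette `((−1,y); 0, j+1)`;
* `sq_temporal_le` — a temporal edge at height `t ≥ 1` is `0` (forest / outside) or a single boundary plaquette:
  `s((t,z),0)² ≤ Φ(t,z) := Σ_j [circ((t,z−e_j);0,j+1)² + circ((t,z);0,j+1)²]`;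
* `sq_spatial_le` — a spatial edge at height `t ≥ 1` by its vertical strip of `(0,i+1)`-plaquettes up to the top face
  (telescoping + Cauchy–Schwarz): `s((t,y),i+1)² ≤ 3(2H+1)·[Σ_{t'∈[1,2H]} circ((t',y);0,i+1)² + Σ_{t'} Φ(t',y) + Σ_{t'} Φ(t',y+e_i)]`;
* `sq_bottom_temporal_le` — a bottom temporal («Polyakov») edge `((0,z),0)` by the transverse sweep of bottom `(0,1)`-plaquettes
  from `z` to the cold wall in direction `e₁`: `≤ 3(2H+1)·Σ_{k ≤ 2H} [circ((0,z+ke₁);0,1)² + circ((−1,z+ke₁);0,1)² + Ψ(z+ke₁)]`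
  for any majorant `Ψ` of the height-one spatial edges.
Parts 2/3 (`…DirichletPoincareSums`) and 3/3 (`…DirPoincareCubic`) sum these bounds against the Dirichlet form and conclude
`stub_dirPoincareCubic`.  Everything proved, no definition, standard axioms.  HONEST LABEL: a glue obligation of a critic-passed line
on the R2ξ″ RECORD-rung crux 24003 (also the C/D-components of LINE-18's stub S2 on 24006); no crux, rung or summit is proved; the
Clay Yang–Mills mass gap is NOT proved by any of this.
-/

set_option autoImplicit false

noncomputable section

open Finset
open scoped Matrix
open Literature.Probability.LatticeModels (Site mem_halfOpenBox halfOpenBox)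
open Literature.MathematicalPhysics.QuantumFieldTheory
open Literature.MathematicalPhysics.QuantumFieldTheory.LatticeMaxwell
open Literature.MathematicalPhysics.QuantumFieldTheory.AxialGauge

namespace Summit.QuantumFields.YangMills.Theorems.AllWindowsColdBox.DirPoincare

open Summit.QuantumFields.YangMills.Theorems.WeakCouplingRates

/-! ## Coordinates `(t, z)` on `ℤ⁴ = ℤ × ℤ³`: sites `Fin.cons t z`, temporal plaquettes `(Fin.cons t w, 0, j.succ)` -/

/-- `(t,z) + e₀ = (t+1, z)`. -/
theorem cons_add_single_zero (t : ℤ) (z : Fin 3 → ℤ) :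
    (Fin.cons t z : Site 4) + Pi.single (0 : Fin 4) (1 : ℤ) = Fin.cons (t + 1) z := by
  ext k
  refine Fin.cases ?_ (fun j => ?_) k
  · simp
  · simp

/-- `(t,z) + e_{j+1} = (t, z + e_j)`. -/
theorem cons_add_single_succ (t : ℤ) (z : Fin 3 → ℤ) (j : Fin 3) :
    (Fin.cons t z : Site 4) + Pi.single j.succ (1 : ℤ) = Fin.cons t (z + Pi.single j 1) := by
  ext k
  refine Fin.cases ?_ (fun i => ?_) k
  · simp
  · by_cases h : i = j
    · subst h; simp
    · simp [Pi.single_eq_of_ne h, Pi.single_eq_of_ne (fun hh => h (Fin.succ_injective _ hh))]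

/-- `Fin.cons` is injective in the pair `(t, z)`. -/
theorem cons_inj2 {t t' : ℤ} {z z' : Fin 3 → ℤ} (h : (Fin.cons t z : Site 4) = Fin.cons t' z') :
    t = t' ∧ z = z' := by
  constructor
  · have := congr_fun h 0; simpa using this
  · funext j; have := congr_fun h j.succ; simpa using this

/-! ## The abstract configuration: zero off the cold box and on the temporal forest -/

section Config

variable {H : ℕ} (s : Literature.MathematicalPhysics.QuantumLattice.ZdEdge 4 → ℝ)
  (hout : ∀ e, e ∉ boxEdges 4 (2 * H + 1) → s e = 0)
  (hforest : ∀ x : Site 4, (∀ k : Fin 4, 1 ≤ x k ∧ x k + 1 ≤ 2 * (H : ℤ)) → s (x, 0) = 0)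

include hout in
/-- An edge whose base point has a coordinate outside `[0, 2H]` carries `0`. -/
theorem s_eq_zero_of_fst {x : Site 4} {i : Fin 4} (hx : ∃ k, x k < 0 ∨ 2 * (H : ℤ) < x k) : s (x, i) = 0 :=
  hout _ (not_mem_boxEdges_of_fst hx)

include hout in
/-- An edge whose far endpoint has a coordinate outside `[0, 2H]` carries `0`. -/
theorem s_eq_zero_of_snd {x : Site 4} {i : Fin 4}
    (hx : ∃ k : Fin 4, (x + Pi.single i (1 : ℤ) : Site 4) k < 0 ∨ 2 * (H : ℤ) < (x + Pi.single i (1 : ℤ) : Site 4) k) :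
    s (x, i) = 0 :=
  hout _ (not_mem_boxEdges_of_snd hx)

include hout in
/-- Time coordinate of the base point outside `[0, 2H]`. -/
theorem s_cons_eq_zero_of_time {t : ℤ} (ht : t < 0 ∨ 2 * (H : ℤ) < t) (z : Fin 3 → ℤ) (i : Fin 4) :
    s (Fin.cons t z, i) = 0 :=
  s_eq_zero_of_fst s hout ⟨0, by simpa using ht⟩

include hout in
/-- A transverse coordinate of the base point outside `[0, 2H]`. -/
theorem s_cons_eq_zero_of_space (t : ℤ) {z : Fin 3 → ℤ} {k : Fin 3} (hz : z k < 0 ∨ 2 * (H : ℤ) < z k)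
    (i : Fin 4) : s (Fin.cons t z, i) = 0 :=
  s_eq_zero_of_fst s hout ⟨k.succ, by simpa using hz⟩

include hout in
/-- A temporal edge at height `≥ 2H` leaves the box. -/
theorem s_cons_zero_eq_zero_of_top {t : ℤ} (ht : 2 * (H : ℤ) ≤ t) (z : Fin 3 → ℤ) :
    s (Fin.cons t z, 0) = 0 :=
  s_eq_zero_of_snd s hout ⟨0, Or.inr (by simp; omega)⟩

include hout in
/-- A spatial edge in direction `j+1` starting at `z_j ≥ 2H` leaves the box. -/
theorem s_cons_succ_eq_zero_of_face (t : ℤ) {z : Fin 3 → ℤ} {j : Fin 3} (hz : 2 * (H : ℤ) ≤ z j) :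
    s (Fin.cons t z, j.succ) = 0 :=
  s_eq_zero_of_snd s hout ⟨j.succ, Or.inr (by simp; omega)⟩

include hforest in
/-- A temporal edge at an interior vertex is on the gauge forest. -/
theorem s_cons_zero_eq_zero_of_interior {t : ℤ} (ht : 1 ≤ t ∧ t + 1 ≤ 2 * (H : ℤ)) {z : Fin 3 → ℤ}
    (hz : ∀ k : Fin 3, 1 ≤ z k ∧ z k + 1 ≤ 2 * (H : ℤ)) : s (Fin.cons t z, 0) = 0 :=
  hforest _ fun k => Fin.cases (by simpa using ht) (fun j => by simpa using hz j) k

/-- The circulation around the temporal plaquette `((t,w); 0, j+1)`, in coordinates. -/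
theorem sCirc_cons (t : ℤ) (w : Fin 3 → ℤ) (j : Fin 3) :
    sCirc s (Fin.cons t w, 0, j.succ) =
      s (Fin.cons t w, 0) + s (Fin.cons (t + 1) w, j.succ) - s (Fin.cons t (w + Pi.single j 1), 0)
        - s (Fin.cons t w, j.succ) := by
  simp only [sCirc, cons_add_single_zero, cons_add_single_succ]


/-! ## Per-edge comb bounds -/

include hout in
/-- **Bottom-face spatial edges are single collar plaquettes**: `s((0,y), j+1) = circ((−1,y); 0, j+1)`. -/
theorem s_bottom_spatial_eq (y : Fin 3 → ℤ) (j : Fin 3) :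
    s (Fin.cons 0 y, j.succ) = sCirc s (Fin.cons (-1) y, 0, j.succ) := by
  rw [sCirc_cons]
  have h1 : s (Fin.cons (-1) y, 0) = 0 := s_cons_eq_zero_of_time s hout (Or.inl (by norm_num)) _ _
  have h2 : s (Fin.cons (-1) (y + Pi.single j 1), 0) = 0 :=
    s_cons_eq_zero_of_time s hout (Or.inl (by norm_num)) _ _
  have h3 : s (Fin.cons (-1) y, j.succ) = 0 := s_cons_eq_zero_of_time s hout (Or.inl (by norm_num)) _ _
  rw [h1, h2, h3]; norm_num

/-- A single term of a sum of three non-negative reals is bounded by the sum (beta-reduced form, avoiding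
higher-order unification in `Finset.single_le_sum`). -/
theorem le_sum_fin_three (F : Fin 3 → ℝ) (hF : ∀ i, 0 ≤ F i) (j : Fin 3) : F j ≤ ∑ i : Fin 3, F i :=
  Finset.single_le_sum (fun i _ => hF i) (Finset.mem_univ j)

include hout hforest in
/-- **Temporal edges at height `t ≥ 1` are `0` or single boundary plaquettes**: for every `t ≥ 1` and every `z`,
`s((t,z),0)² ≤ Σ_j [circ((t, z − e_j); 0, j+1)² + circ((t,z); 0, j+1)²]`. -/
theorem sq_temporal_le (t : ℤ) (ht : 1 ≤ t) (z : Fin 3 → ℤ) :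
    s (Fin.cons t z, 0) ^ 2 ≤
      ∑ j : Fin 3, (sCirc s (Fin.cons t (z - Pi.single j 1), 0, j.succ) ^ 2 + sCirc s (Fin.cons t z, 0, j.succ) ^ 2) := by
  set F : Fin 3 → ℝ := fun j => sCirc s (Fin.cons t (z - Pi.single j 1), 0, j.succ) ^ 2 +
    sCirc s (Fin.cons t z, 0, j.succ) ^ 2 with hF
  have hFn : ∀ j, 0 ≤ F j := fun j => by simp only [hF]; positivity
  have hnn : 0 ≤ ∑ j : Fin 3, F j := Finset.sum_nonneg fun j _ => hFn j
  -- trivial cases: the edge carries 0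
  by_cases htop : 2 * (H : ℤ) ≤ t
  · rw [s_cons_zero_eq_zero_of_top s hout htop, zero_pow two_ne_zero]; exact hnn
  by_cases hsp : ∃ k : Fin 3, z k < 0 ∨ 2 * (H : ℤ) < z k
  · obtain ⟨k, hk⟩ := hsp
    rw [s_cons_eq_zero_of_space s hout t hk, zero_pow two_ne_zero]; exact hnn
  push Not at hsp
  by_cases hin : ∀ k : Fin 3, 1 ≤ z k ∧ z k + 1 ≤ 2 * (H : ℤ)
  · rw [s_cons_zero_eq_zero_of_interior s hforest ⟨ht, by omega⟩ hin, zero_pow two_ne_zero]; exact hnn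
  push Not at hin
  obtain ⟨j, hj⟩ := hin
  have hzj := hsp j
  have hface : z j = 0 ∨ z j = 2 * (H : ℤ) := by omega
  refine le_trans ?_ (le_sum_fin_three F hFn j)
  rcases hface with hj0 | hj2
  · -- face `z_j = 0`: the plaquette based at `z − e_j` (lateral collar)
    have hc : sCirc s (Fin.cons t (z - Pi.single j 1), 0, j.succ) = - s (Fin.cons t z, 0) := by
      rw [sCirc_cons]
      have e1 : s (Fin.cons t (z - Pi.single j 1), 0) = 0 :=
        s_cons_eq_zero_of_space s hout t (k := j) (Or.inl (by simp [hj0])) _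
      have e2 : s (Fin.cons (t + 1) (z - Pi.single j 1), j.succ) = 0 :=
        s_cons_eq_zero_of_space s hout (t + 1) (k := j) (Or.inl (by simp [hj0])) _
      have e3 : z - Pi.single j 1 + Pi.single j 1 = z := by simp
      have e4 : s (Fin.cons t (z - Pi.single j 1), j.succ) = 0 :=
        s_cons_eq_zero_of_space s hout t (k := j) (Or.inl (by simp [hj0])) _
      rw [e1, e2, e3, e4]; ring
    have h1 : s (Fin.cons t z, 0) ^ 2 = sCirc s (Fin.cons t (z - Pi.single j 1), 0, j.succ) ^ 2 := by rw [hc]; ring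
    rw [h1, hF]
    nlinarith [sq_nonneg (sCirc s (Fin.cons t z, 0, j.succ))]
  · -- face `z_j = 2H`: the plaquette based at `z`
    have hc : sCirc s (Fin.cons t z, 0, j.succ) = s (Fin.cons t z, 0) := by
      rw [sCirc_cons]
      have e2 : s (Fin.cons (t + 1) z, j.succ) = 0 := s_cons_succ_eq_zero_of_face s hout (t + 1) (by omega)
      have e3 : s (Fin.cons t (z + Pi.single j 1), 0) = 0 :=
        s_cons_eq_zero_of_space s hout t (k := j) (Or.inr (by simp [hj2])) _
      have e4 : s (Fin.cons t z, j.succ) = 0 := s_cons_succ_eq_zero_of_face s hout t (by omega)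
      rw [e2, e3, e4]; ring
    have h1 : s (Fin.cons t z, 0) ^ 2 = sCirc s (Fin.cons t z, 0, j.succ) ^ 2 := by rw [hc]
    rw [h1, hF]
    nlinarith [sq_nonneg (sCirc s (Fin.cons t (z - Pi.single j 1), 0, j.succ))]

/-- Cauchy–Schwarz on `range n`: `(Σ_{m<n} f m)² ≤ n · Σ_{m<n} (f m)²`. -/
theorem sq_sum_range_le (n : ℕ) (f : ℕ → ℝ) :
    (∑ m ∈ Finset.range n, f m) ^ 2 ≤ n * ∑ m ∈ Finset.range n, f m ^ 2 := by
  have h := sq_sum_le_card_mul_sum_sq (s := Finset.range n) (f := f)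
  simpa using h

/-- A shifted partial sum of non-negative terms is dominated by the sum over `[1, 2H]`:
`Σ_{m<n} g(t+m) ≤ Σ_{t' ∈ [1,2H]} g t'` when `1 ≤ t` and `t + n ≤ 2H + 1`. -/
theorem sum_range_shift_le (g : ℕ → ℝ) (hg : ∀ k, 0 ≤ g k) {t n : ℕ} (ht : 1 ≤ t) (htn : t + n ≤ 2 * H + 1) :
    ∑ m ∈ Finset.range n, g (t + m) ≤ ∑ t' ∈ Finset.Icc 1 (2 * H), g t' := by
  have h1 : ∑ m ∈ Finset.range n, g (t + m) = ∑ k ∈ Finset.Ico t (t + n), g k := by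
    rw [Finset.sum_Ico_eq_sum_range]; simp
  rw [h1]
  refine Finset.sum_le_sum_of_subset_of_nonneg (fun k hk => ?_) (fun k _ _ => hg k)
  rw [Finset.mem_Ico] at hk; rw [Finset.mem_Icc]; omega

include hout in
/-- **Spatial edges by the vertical strip** (the comb): for `t ≥ 1`, every direction `i+1` and every `y`, given any bound
`Φ t' z ≥ s((t',z),0)²` for the temporal edges at heights `t' ≥ 1`,
`s((t,y), i+1)² ≤ 3(2H+1)·[Σ_{t'∈[1,2H]} circ((t',y);0,i+1)² + Σ_{t'} Φ t' y + Σ_{t'} Φ t' (y+e_i)]`. -/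
theorem sq_spatial_le (Φ : ℤ → (Fin 3 → ℤ) → ℝ) (hΦ0 : ∀ t z, 0 ≤ Φ t z)
    (hΦ : ∀ t : ℤ, 1 ≤ t → ∀ z, s (Fin.cons t z, 0) ^ 2 ≤ Φ t z)
    (t : ℕ) (ht : 1 ≤ t) (y : Fin 3 → ℤ) (i : Fin 3) :
    s (Fin.cons (t : ℤ) y, i.succ) ^ 2 ≤
      3 * (2 * H + 1) * (∑ t' ∈ Finset.Icc 1 (2 * H), sCirc s (Fin.cons (t' : ℤ) y, 0, i.succ) ^ 2 +
        ∑ t' ∈ Finset.Icc 1 (2 * H), Φ t' y + ∑ t' ∈ Finset.Icc 1 (2 * H), Φ t' (y + Pi.single i 1)) := by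
  have hS0 : 0 ≤ ∑ t' ∈ Finset.Icc 1 (2 * H), sCirc s (Fin.cons (t' : ℤ) y, 0, i.succ) ^ 2 :=
    Finset.sum_nonneg fun _ _ => by positivity
  have hA0 : 0 ≤ ∑ t' ∈ Finset.Icc 1 (2 * H), Φ t' y := Finset.sum_nonneg fun _ _ => hΦ0 _ _
  have hB0 : 0 ≤ ∑ t' ∈ Finset.Icc 1 (2 * H), Φ t' (y + Pi.single i 1) := Finset.sum_nonneg fun _ _ => hΦ0 _ _
  by_cases htop : 2 * H < t
  · rw [s_cons_eq_zero_of_time s hout (t := (t : ℤ)) (Or.inr (by exact_mod_cast htop)), zero_pow two_ne_zero]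
    positivity
  push Not at htop
  -- the strip `t' = t + m`, `m < n := 2H + 1 − t`
  set n : ℕ := 2 * H + 1 - t with hn
  have htn : t + n = 2 * H + 1 := by omega
  set a : ℕ → ℝ := fun m => s (Fin.cons ((t : ℤ) + m) y, i.succ) with ha
  set b : ℕ → ℝ := fun m => s (Fin.cons ((t : ℤ) + m) y, 0) with hb
  set b' : ℕ → ℝ := fun m => s (Fin.cons ((t : ℤ) + m) (y + Pi.single i 1), 0) with hb'
  set c : ℕ → ℝ := fun m => sCirc s (Fin.cons ((t : ℤ) + m) y, 0, i.succ) with hc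
  -- the plaquette identity along the strip
  have hstep : ∀ m : ℕ, c m = b m + a (m + 1) - b' m - a m := fun m => by
    simp only [hc, ha, hb, hb', sCirc_cons, Nat.cast_add, Nat.cast_one]
    ring_nf
  -- telescoping
  have htel : ∑ m ∈ Finset.range n, (a (m + 1) - a m) = a n - a 0 := Finset.sum_range_sub a n
  have han : a n = 0 := by
    simp only [ha]
    exact s_cons_eq_zero_of_time s hout (Or.inr (by omega)) _ _
  have ha0 : a 0 = s (Fin.cons (t : ℤ) y, i.succ) := by simp [ha]
  have hid : s (Fin.cons (t : ℤ) y, i.succ) =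
      -(∑ m ∈ Finset.range n, c m) + (∑ m ∈ Finset.range n, b m) + (-(∑ m ∈ Finset.range n, b' m)) := by
    have : ∑ m ∈ Finset.range n, c m =
        ∑ m ∈ Finset.range n, b m + ∑ m ∈ Finset.range n, (a (m + 1) - a m) - ∑ m ∈ Finset.range n, b' m := by
      rw [← Finset.sum_add_distrib, ← Finset.sum_sub_distrib]
      exact Finset.sum_congr rfl fun m _ => by rw [hstep]; ring
    rw [this, htel, han, ha0]; ring
  -- Cauchy–Schwarz three times
  have hn_le : (n : ℝ) ≤ 2 * H + 1 := by exact_mod_cast (show n ≤ 2 * H + 1 by omega)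
  have h1 : (∑ m ∈ Finset.range n, c m) ^ 2 ≤ n * ∑ m ∈ Finset.range n, c m ^ 2 := sq_sum_range_le n c
  have h2 : (∑ m ∈ Finset.range n, b m) ^ 2 ≤ n * ∑ m ∈ Finset.range n, b m ^ 2 := sq_sum_range_le n b
  have h3 : (∑ m ∈ Finset.range n, b' m) ^ 2 ≤ n * ∑ m ∈ Finset.range n, b' m ^ 2 := sq_sum_range_le n b'
  -- the three partial sums are dominated by the full families
  have hc_le : ∑ m ∈ Finset.range n, c m ^ 2 ≤ ∑ t' ∈ Finset.Icc 1 (2 * H), sCirc s (Fin.cons (t' : ℤ) y, 0, i.succ) ^ 2 := by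
    have := sum_range_shift_le (H := H) (fun k => sCirc s (Fin.cons (k : ℤ) y, 0, i.succ) ^ 2) (fun _ => by positivity) ht
      (le_of_eq htn)
    simpa only [hc, Nat.cast_add] using this
  have hb_le : ∑ m ∈ Finset.range n, b m ^ 2 ≤ ∑ t' ∈ Finset.Icc 1 (2 * H), Φ t' y := by
    have hbm : ∀ m ∈ Finset.range n, b m ^ 2 ≤ Φ ((t + m : ℕ) : ℤ) y := fun m _ => by
      simp only [hb]; push_cast; exact hΦ _ (by omega) _
    refine (Finset.sum_le_sum hbm).trans ?_
    exact sum_range_shift_le (H := H) (fun k => Φ k y) (fun _ => hΦ0 _ _) ht (le_of_eq htn)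
  have hb'_le : ∑ m ∈ Finset.range n, b' m ^ 2 ≤ ∑ t' ∈ Finset.Icc 1 (2 * H), Φ t' (y + Pi.single i 1) := by
    have hbm : ∀ m ∈ Finset.range n, b' m ^ 2 ≤ Φ ((t + m : ℕ) : ℤ) (y + Pi.single i 1) := fun m _ => by
      simp only [hb']; push_cast; exact hΦ _ (by omega) _
    refine (Finset.sum_le_sum hbm).trans ?_
    exact sum_range_shift_le (H := H) (fun k => Φ k (y + Pi.single i 1)) (fun _ => hΦ0 _ _) ht (le_of_eq htn)
  rw [hid]
  have h3sq : ∀ a b c : ℝ, (a + b + c) ^ 2 ≤ 3 * (a ^ 2 + b ^ 2 + c ^ 2) := fun a b c => by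
    nlinarith [sq_nonneg (a - b), sq_nonneg (b - c), sq_nonneg (a - c)]
  refine (h3sq _ _ _).trans ?_
  rw [neg_sq, neg_sq]
  have hn0 : (0 : ℝ) ≤ n := Nat.cast_nonneg n
  calc 3 * ((∑ m ∈ Finset.range n, c m) ^ 2 + (∑ m ∈ Finset.range n, b m) ^ 2 + (∑ m ∈ Finset.range n, b' m) ^ 2)
      ≤ 3 * (n * ∑ m ∈ Finset.range n, c m ^ 2 + n * ∑ m ∈ Finset.range n, b m ^ 2 +
          n * ∑ m ∈ Finset.range n, b' m ^ 2) := by linarith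
    _ ≤ 3 * (n * ∑ t' ∈ Finset.Icc 1 (2 * H), sCirc s (Fin.cons (t' : ℤ) y, 0, i.succ) ^ 2 +
          n * ∑ t' ∈ Finset.Icc 1 (2 * H), Φ t' y + n * ∑ t' ∈ Finset.Icc 1 (2 * H), Φ t' (y + Pi.single i 1)) := by
        gcongr
    _ ≤ 3 * (2 * H + 1) * (∑ t' ∈ Finset.Icc 1 (2 * H), sCirc s (Fin.cons (t' : ℤ) y, 0, i.succ) ^ 2 +
        ∑ t' ∈ Finset.Icc 1 (2 * H), Φ t' y + ∑ t' ∈ Finset.Icc 1 (2 * H), Φ t' (y + Pi.single i 1)) := by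
        nlinarith

include hout in
/-- **Bottom temporal («Polyakov») edges by the transverse sweep**: for `z` with `z₀ ≥ 0`, sweeping the bottom
`(0,1)`-plaquettes from `z` in the direction `e₁` until the cold wall, given any bound `Ψ w ≥ s((1,w), 1)²` for the
height-one spatial edges,
`s((0,z),0)² ≤ 3(2H+1)·Σ_{k ≤ 2H} [circ((0, z+k e₁); 0,1)² + circ((−1, z+k e₁); 0,1)² + Ψ(z + k e₁)]`. -/
theorem sq_bottom_temporal_le (Ψ : (Fin 3 → ℤ) → ℝ)
    (hΨ : ∀ w, s (Fin.cons 1 w, (0 : Fin 3).succ) ^ 2 ≤ Ψ w) (z : Fin 3 → ℤ) (hz : 0 ≤ z 0) :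
    s (Fin.cons 0 z, 0) ^ 2 ≤
      3 * (2 * H + 1) * ∑ k ∈ Finset.range (2 * H + 1),
        (sCirc s (Fin.cons 0 (z + Pi.single 0 (k : ℤ)), 0, (0 : Fin 3).succ) ^ 2 +
          sCirc s (Fin.cons (-1) (z + Pi.single 0 (k : ℤ)), 0, (0 : Fin 3).succ) ^ 2 + Ψ (z + Pi.single 0 (k : ℤ))) := by
  set K : ℕ := 2 * H + 1 with hK
  set w : ℕ → (Fin 3 → ℤ) := fun k => z + Pi.single 0 (k : ℤ) with hw
  set bt : ℕ → ℝ := fun k => s (Fin.cons 0 (w k), 0) with hbt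
  set u : ℕ → ℝ := fun k => s (Fin.cons 1 (w k), (0 : Fin 3).succ) with hu
  set d : ℕ → ℝ := fun k => s (Fin.cons 0 (w k), (0 : Fin 3).succ) with hd
  set c : ℕ → ℝ := fun k => sCirc s (Fin.cons 0 (w k), 0, (0 : Fin 3).succ) with hc
  have hwsucc : ∀ k : ℕ, w k + Pi.single 0 1 = w (k + 1) := fun k => by
    simp only [hw, add_assoc, ← Pi.single_add]; push_cast; rfl
  -- the plaquette identity along the sweep
  have hstep : ∀ k : ℕ, c k = bt k + u k - bt (k + 1) - d k := fun k => by
    simp only [hc, hbt, hu, hd, sCirc_cons, hwsucc]; norm_num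
  -- telescoping
  have htel : ∑ k ∈ Finset.range K, (bt (k + 1) - bt k) = bt K - bt 0 := Finset.sum_range_sub bt K
  have hbtK : bt K = 0 := by
    simp only [hbt, hw]
    exact s_cons_eq_zero_of_space s hout 0 (k := 0) (Or.inr (by simp; omega)) _
  have hbt0 : bt 0 = s (Fin.cons 0 z, 0) := by simp [hbt, hw]
  have hid : s (Fin.cons 0 z, 0) = ∑ k ∈ Finset.range K, (c k + (-u k) + d k) := by
    have : ∑ k ∈ Finset.range K, (c k + (-u k) + d k) = -∑ k ∈ Finset.range K, (bt (k + 1) - bt k) := by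
      rw [← Finset.sum_neg_distrib]
      exact Finset.sum_congr rfl fun k _ => by rw [hstep]; ring
    rw [this, htel, hbtK, hbt0]; ring
  -- bottom spatial edges are collar plaquettes
  have hdk : ∀ k, d k = sCirc s (Fin.cons (-1) (w k), 0, (0 : Fin 3).succ) := fun k => by
    simp only [hd]; exact s_bottom_spatial_eq s hout _ _
  rw [hid]
  refine (sq_sum_range_le K _).trans ?_
  have hK' : (K : ℝ) = 2 * H + 1 := by simp [hK]
  rw [hK', Finset.mul_sum, Finset.mul_sum]
  refine Finset.sum_le_sum fun k _ => ?_
  have h3 : (c k + -u k + d k) ^ 2 ≤ 3 * (c k ^ 2 + u k ^ 2 + d k ^ 2) := by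
    nlinarith [sq_nonneg (c k + u k), sq_nonneg (u k + d k), sq_nonneg (c k - d k)]
  have huk : u k ^ 2 ≤ Ψ (w k) := hΨ (w k)
  have hpos : (0 : ℝ) ≤ 2 * H + 1 := by positivity
  calc (2 * (H : ℝ) + 1) * (c k + -u k + d k) ^ 2 ≤ (2 * H + 1) * (3 * (c k ^ 2 + u k ^ 2 + d k ^ 2)) := by gcongr
    _ ≤ 3 * (2 * H + 1) * (c k ^ 2 + sCirc s (Fin.cons (-1) (w k), 0, (0 : Fin 3).succ) ^ 2 + Ψ (w k)) := by
        rw [← hdk k]; nlinarith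

end Config

/-! ## Reindexing the box edges by `(t, z, i)` -/

/-- The box edges are among the edges `((t,z), i)`, `t ≤ 2H`, `z ∈ {0,…,2H}³`. -/
theorem sum_boxEdges_le_sum_cons {H : ℕ} (f : Literature.MathematicalPhysics.QuantumLattice.ZdEdge 4 → ℝ) (hf : ∀ e, 0 ≤ f e) :
    ∑ e ∈ boxEdges 4 (2 * H + 1), f e ≤
      ∑ t ∈ Finset.range (2 * H + 1), ∑ z ∈ halfOpenBox 3 (2 * H + 1), ∑ i : Fin 4, f (Fin.cons (t : ℤ) z, i) := by
  classical
  set A := Finset.range (2 * H + 1) ×ˢ (halfOpenBox 3 (2 * H + 1) ×ˢ (Finset.univ : Finset (Fin 4))) with hA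
  set ψ : ℕ × (Fin 3 → ℤ) × Fin 4 → Literature.MathematicalPhysics.QuantumLattice.ZdEdge 4 :=
    fun a => ((Fin.cons (a.1 : ℤ) a.2.1 : Site 4), a.2.2) with hψ
  have hinj : Set.InjOn ψ A := by
    intro a _ b _ hab
    simp only [hψ, Prod.mk.injEq] at hab
    have h2 := cons_inj2 hab.1
    exact Prod.ext (by exact_mod_cast h2.1) (Prod.ext h2.2 hab.2)
  have hrhs : ∑ t ∈ Finset.range (2 * H + 1), ∑ z ∈ halfOpenBox 3 (2 * H + 1), ∑ i : Fin 4, f (Fin.cons (t : ℤ) z, i) =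
      ∑ e ∈ A.image ψ, f e := by
    rw [Finset.sum_image hinj, hA, Finset.sum_product]
    refine Finset.sum_congr rfl fun t _ => ?_
    rw [Finset.sum_product]
  rw [hrhs]
  refine Finset.sum_le_sum_of_subset_of_nonneg (fun e he => ?_) fun e _ _ => hf e
  obtain ⟨x, i⟩ := e
  have hx := (mem_boxEdges_iff.1 he).1
  refine Finset.mem_image.2 ⟨((x 0).toNat, Fin.tail x, i), ?_, ?_⟩
  · simp only [hA, Finset.mem_product, Finset.mem_range, Finset.mem_univ, and_true, mem_halfOpenBox]
    refine ⟨?_, fun j => ?_⟩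
    · have := hx 0; push_cast at this; omega
    · have := hx j.succ; push_cast at this; exact this
  · simp only [hψ, Prod.mk.injEq, and_true]
    have h0 : (((x 0).toNat : ℕ) : ℤ) = x 0 := Int.toNat_of_nonneg (hx 0).1
    rw [h0]; exact Fin.cons_self_tail x

end Summit.QuantumFields.YangMills.Theorems.AllWindowsColdBox.DirPoincare

end
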